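import Literature.Probability.Distributions.BrascampLiebHalfLine
import Literature.NumberTheory.LFunctions.XiTiltedPotential
import Literature.NumberTheory.LFunctions.XiMoments

/-!
# Route `JensenPolynomials`, support item `XiDeltaLower052` — part 1: Brascamp–Lieb for the tilted law with the test
function `u⁻²` (RH-FREE; cell rh-jensen, HUMAN RULING D-0040)

For `ν_{m+4} ∝ u^{m+4}Φ(u)du` (`Φ` the Pólya–de Bruijn kernel) and `U = u⁻²`, Brascamp–Lieb's variance inequality
(`Literature.Probability.Distributions.brascampLieb_Ioi`, potential `W = xiPotential (m+4)`, `W″ = (m+4)/u² + V`,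
`V > 16πe^{4u}` by Coffey–Csordas' quantitative log-concavity `xiPotentialDeriv₂_gt_of_pos`) with the two-piece weight
bound `4u⁻⁶/W″ ≤ 4u⁻⁴/((m+4) + 16πu²e^{4u})` split at a cut `u₀` gives (`xiMoment_mul_le_sq_of_bl`):

  `M_m · M_{m+4} · (1 − 4/((m+4) + D) − (4/(m+4))·I₀/M_m) ≤ M_{m+2}²`,  `I₀ = ∫₀^{u₀} Φu^m`, any `0 ≤ D ≤ 16πu₀²e^{4u₀}`,

(variance ≤ second moment about `a⁻²`, `a` a critical point of `W_{m+4}`; `E_ν[U²] = M_m/M_{m+4}`, `E_ν[U] = M_{m+2}/M_{m+4}`).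
Design: rh-jensen-eng-5 ET3.md §5 (one-cell Brascamp–Lieb); identity checked by rh-jensen-theory g7. Part 2
(`JensenPolynomialsXiDeltaLower.lean`) supplies the cut (`u₀ = a − 1/10` below the mode `a ≥ 1.69` of `W_m`, `D = 4(m+4)`,
`I₀/M_m ≤ 1/40`) and the moment dictionary, and closes the item `δ(M) = 2MΔ(M)² ≥ 13/25` (`M ≥ 10⁴`).
WHAT THIS IS NOT: nothing here bears on the zeros of `ζ`. References: Brascamp–Lieb, J. Funct. Anal. 22 (1976) Thm 4.1
[BrascampLieb1976]; Coffey–Csordas, Math. Comp. 82 (2013) Thm 2.4 [CoffeyCsordas2013]; GORZ, PNAS 116 (2019) Thm 7 [GORZPNAS2019].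
-/

noncomputable section
-- D-0017: `Summit.RiemannHypothesis.RiemannHypothesis.…` duplicates the namespace BY DESIGN (single-problem summit).
set_option linter.dupNamespace false

namespace Summit.RiemannHypothesis.RiemannHypothesis.Theorems.JensenPolynomials

open Literature.NumberTheory.LFunctions Literature.Probability.Distributions MeasureTheory Set Filter
open scoped Topology ENNReal Nat

/-! ## 1. Brascamp–Lieb for `ν_{m+4}` with the test function `u⁻²` and a two-piece weight bound -/

/-- Derivative of `u ↦ (u²)⁻¹`: `−2/u³` (`u ≠ 0`). -/
theorem hasDerivAt_inv_sq {u : ℝ} (hu : u ≠ 0) :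
    HasDerivAt (fun x : ℝ => (x ^ 2)⁻¹) (-2 / u ^ 3) u := by
  have h := ((hasDerivAt_pow 2 u).inv (pow_ne_zero 2 hu))
  refine h.congr_deriv ?_
  field_simp
  ring

/-- **BL, extended-integral form**: for `m : ℕ`, `k = m + 4`, a critical point `a > 0` of `W_k`, a cut `u₀ > 0` and
`D ≥ 0` with `D ≤ 16πu₀²e^{4u₀}`:
`∫₀^∞ (u⁻² − a⁻²)² u^kΦ ≤ (4/(k + D))·∫_{u ≥ u₀} u^mΦ + (4/k)·∫_{u < u₀} u^mΦ` (as `lintegral`s). -/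
theorem lintegral_invSq_var_le (m : ℕ) {a u₀ D : ℝ} (ha : 0 < a) (hu₀ : 0 < u₀) (hD0 : 0 ≤ D)
    (hD : D ≤ 16 * Real.pi * (u₀ ^ 2 * Real.exp (4 * u₀)))
    (hmode : ((m + 4 : ℕ) : ℝ) / a + deBruijnPhiDeriv a / deBruijnPhi a = 0) :
    ∫⁻ u in Ioi (0 : ℝ), ENNReal.ofReal (((u ^ 2)⁻¹ - (a ^ 2)⁻¹) ^ 2 * (deBruijnPhi u * u ^ (m + 4))) ≤
      ENNReal.ofReal (4 / ((m + 4 : ℝ) + D)) * (∫⁻ u in Ioi (0 : ℝ) ∩ Ici u₀, ENNReal.ofReal (deBruijnPhi u * u ^ m)) +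
      ENNReal.ofReal (4 / (m + 4 : ℝ)) * (∫⁻ u in Ioi (0 : ℝ) ∩ Iio u₀, ENNReal.ofReal (deBruijnPhi u * u ^ m)) := by
  have hkR : (((m + 4 : ℕ)) : ℝ) = (m : ℝ) + 4 := by push_cast; ring
  -- Brascamp–Lieb with `g = W_{m+4}`, `H = u⁻²`
  have hga : xiPotentialDeriv ((m + 4 : ℕ) : ℝ) a = 0 := by
    rw [xiPotentialDeriv, phiNegLogDeriv]
    have : -((((m + 4 : ℕ)) : ℝ) / a) + -deBruijnPhiDeriv a / deBruijnPhi a =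
        -((((m + 4 : ℕ)) : ℝ) / a + deBruijnPhiDeriv a / deBruijnPhi a) := by ring
    rw [this, hmode, neg_zero]
  have key := brascampLieb_Ioi (l := 0) (a := a) ha (g := xiPotential ((m + 4 : ℕ) : ℝ))
    (g₁ := xiPotentialDeriv ((m + 4 : ℕ) : ℝ))
    (g₂ := xiPotentialDeriv₂ ((m + 4 : ℕ) : ℝ)) (H := fun x : ℝ => (x ^ 2)⁻¹) (H₁ := fun x : ℝ => -2 / x ^ 3)
    (fun x hx => hasDerivAt_xiPotential _ (ne_of_gt hx)) (fun x hx => hasDerivAt_xiPotentialDeriv _ (ne_of_gt hx))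
    (fun x hx => hasDerivAt_inv_sq (ne_of_gt hx))
    ((continuousOn_xiPotentialDeriv₂ _).mono fun x hx => ne_of_gt (mem_Ioi.mp hx))
    ((continuousOn_const.div (continuousOn_id.pow 3) fun x hx => pow_ne_zero 3 (ne_of_gt hx)))
    (fun x _ => xiPotentialDeriv₂_pos (Nat.cast_nonneg _) x) hga
  -- rewrite the left side of `key` into the weight `Φ u^{m+4}`
  have hcongr : EqOn (fun u : ℝ => ENNReal.ofReal (((u ^ 2)⁻¹ - (a ^ 2)⁻¹) ^ 2 * (deBruijnPhi u * u ^ (m + 4))))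
      (fun u : ℝ => ENNReal.ofReal ((((fun x : ℝ => (x ^ 2)⁻¹) u - (fun x : ℝ => (x ^ 2)⁻¹) a) ^ 2 *
        Real.exp (-xiPotential ((m + 4 : ℕ) : ℝ) u)))) (Ioi 0) := by
    intro u hu
    simp only [exp_neg_xiPotential_natCast (m + 4) hu]
    ring_nf
  rw [setLIntegral_congr_fun measurableSet_Ioi hcongr]
  refine key.trans ?_
  -- split the right side at `u₀`
  have hsplit : Ioi (0 : ℝ) = (Ioi 0 ∩ Ici u₀) ∪ (Ioi 0 ∩ Iio u₀) := by
    rw [← inter_union_distrib_left, Ici_union_Iio, inter_univ]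
  have hdisj : Disjoint (Ioi (0 : ℝ) ∩ Ici u₀) (Ioi 0 ∩ Iio u₀) :=
    Disjoint.mono inter_subset_right inter_subset_right
      (disjoint_left.2 fun x hx hx' => (not_lt.2 (mem_Ici.1 hx)) (mem_Iio.1 hx'))
  set F : ℝ → ℝ≥0∞ := fun x => ENNReal.ofReal ((-2 / x ^ 3) ^ 2 / xiPotentialDeriv₂ ((m + 4 : ℕ) : ℝ) x *
    Real.exp (-xiPotential ((m + 4 : ℕ) : ℝ) x)) with hF
  have hsplitInt : ∫⁻ x in Ioi (0 : ℝ), F x = (∫⁻ x in Ioi (0 : ℝ) ∩ Ici u₀, F x) + ∫⁻ x in Ioi (0 : ℝ) ∩ Iio u₀, F x := by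
    rw [← lintegral_union (measurableSet_Ioi.inter measurableSet_Iio) hdisj, ← hsplit]
  rw [hsplitInt]
  -- the common pointwise estimate `(−2/u³)²/W″ · u^{m+4}Φ ≤ 4u^mΦ/((m+4) + 16πu²e^{4u})`
  have hpt : ∀ u : ℝ, 0 < u → (-2 / u ^ 3) ^ 2 / xiPotentialDeriv₂ ((m + 4 : ℕ) : ℝ) u *
      Real.exp (-xiPotential ((m + 4 : ℕ) : ℝ) u) ≤
      4 * (deBruijnPhi u * u ^ m) / ((m + 4 : ℝ) + 16 * Real.pi * (u ^ 2 * Real.exp (4 * u))) := by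
    intro u hu
    rw [exp_neg_xiPotential_natCast (m + 4) hu]
    have hW := xiPotentialDeriv₂_gt_of_pos ((m + 4 : ℕ) : ℝ) hu
    have hΦ := deBruijnPhi_pos_holds u
    have hden : 0 < (m + 4 : ℝ) + 16 * Real.pi * (u ^ 2 * Real.exp (4 * u)) := by positivity
    have hden' : 0 < (((m + 4 : ℕ)) : ℝ) / u ^ 2 + 16 * Real.pi * Real.exp (4 * u) := by positivity
    have hW0 : 0 < xiPotentialDeriv₂ ((m + 4 : ℕ) : ℝ) u := lt_trans hden' hW
    have e1 : (-2 / u ^ 3) ^ 2 / xiPotentialDeriv₂ ((m + 4 : ℕ) : ℝ) u * (u ^ (m + 4) * deBruijnPhi u) =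
        4 * (deBruijnPhi u * u ^ m) / (u ^ 2 * xiPotentialDeriv₂ ((m + 4 : ℕ) : ℝ) u) := by
      field_simp; ring
    rw [e1, div_le_div_iff_of_pos_left (by positivity) (by positivity) hden]
    have : (m + 4 : ℝ) + 16 * Real.pi * (u ^ 2 * Real.exp (4 * u)) =
        u ^ 2 * ((((m + 4 : ℕ)) : ℝ) / u ^ 2 + 16 * Real.pi * Real.exp (4 * u)) := by
      push_cast; field_simp
    rw [this]
    exact mul_le_mul_of_nonneg_left hW.le (by positivity)
  have hw0 : ∀ u : ℝ, 0 < u → 0 ≤ deBruijnPhi u * u ^ m := fun u hu => by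
    have := deBruijnPhi_pos_holds u; positivity
  refine add_le_add ?_ ?_
  · rw [← lintegral_const_mul' _ _ ENNReal.ofReal_ne_top]
    refine setLIntegral_mono' (measurableSet_Ioi.inter measurableSet_Ici) fun u hu => ?_
    have hu0 : 0 < u := hu.1
    have hu2 : u₀ ≤ u := hu.2
    rw [hF, ← ENNReal.ofReal_mul (by positivity)]
    refine ENNReal.ofReal_le_ofReal ((hpt u hu0).trans ?_)
    have hmono : u₀ ^ 2 * Real.exp (4 * u₀) ≤ u ^ 2 * Real.exp (4 * u) :=
      mul_le_mul (pow_le_pow_left₀ hu₀.le hu2 2) (Real.exp_le_exp.2 (by linarith))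
        (Real.exp_pos _).le (by positivity)
    rw [div_eq_mul_inv, show 4 * (deBruijnPhi u * u ^ m) * ((m + 4 : ℝ) +
      16 * Real.pi * (u ^ 2 * Real.exp (4 * u)))⁻¹ = 4 / ((m + 4 : ℝ) +
      16 * Real.pi * (u ^ 2 * Real.exp (4 * u))) * (deBruijnPhi u * u ^ m) by ring]
    refine mul_le_mul_of_nonneg_right ?_ (hw0 u hu0)
    exact div_le_div_of_nonneg_left (by norm_num) (by positivity) (by nlinarith [Real.pi_pos])
  · rw [← lintegral_const_mul' _ _ ENNReal.ofReal_ne_top]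
    refine setLIntegral_mono' (measurableSet_Ioi.inter measurableSet_Iio) fun u hu => ?_
    have hu0 : 0 < u := hu.1
    rw [hF, ← ENNReal.ofReal_mul (by positivity)]
    refine ENNReal.ofReal_le_ofReal ((hpt u hu0).trans ?_)
    rw [div_eq_mul_inv, show 4 * (deBruijnPhi u * u ^ m) * ((m + 4 : ℝ) +
      16 * Real.pi * (u ^ 2 * Real.exp (4 * u)))⁻¹ = 4 / ((m + 4 : ℝ) +
      16 * Real.pi * (u ^ 2 * Real.exp (4 * u))) * (deBruijnPhi u * u ^ m) by ring]
    refine mul_le_mul_of_nonneg_right ?_ (hw0 u hu0)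
    have : 0 ≤ 16 * Real.pi * (u ^ 2 * Real.exp (4 * u)) := by positivity
    exact div_le_div_of_nonneg_left (by norm_num) (by positivity) (by linarith)

/-! ## 2. Bochner form and the moment inequality `M_m M_{m+4}(1 − c₁ − c₂P′) ≤ M_{m+2}²` -/

/-- The integrand `(u⁻² − a⁻²)² Φu^{m+4}` is the polynomial combination `(Φu^m a⁴ − 2a²Φu^{m+2} + Φu^{m+4})/a⁴` on
`u > 0`. -/
theorem invSq_var_integrand_eq (m : ℕ) {a u : ℝ} (ha : 0 < a) (hu : 0 < u) :
    ((u ^ 2)⁻¹ - (a ^ 2)⁻¹) ^ 2 * (deBruijnPhi u * u ^ (m + 4)) =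
      (a ^ 4)⁻¹ * (a ^ 4 * (deBruijnPhi u * u ^ m) - 2 * a ^ 2 * (deBruijnPhi u * u ^ (m + 2)) +
        deBruijnPhi u * u ^ (m + 4)) := by
  have hu' : u ≠ 0 := hu.ne'
  have ha' : a ≠ 0 := ha.ne'
  field_simp
  ring

/-- **The moment inequality from Brascamp–Lieb**: with `I₀ = ∫₀^{u₀} Φu^m` and `D ≤ 16πu₀²e^{4u₀}`,
`M_m·M_{m+4}·(1 − 4/((m+4)+D) − (4/(m+4))·I₀/M_m) ≤ M_{m+2}²`. -/
theorem xiMoment_mul_le_sq_of_bl (m : ℕ) {a u₀ D : ℝ} (ha : 0 < a) (hu₀ : 0 < u₀) (hD0 : 0 ≤ D)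
    (hD : D ≤ 16 * Real.pi * (u₀ ^ 2 * Real.exp (4 * u₀)))
    (hmode : ((m + 4 : ℕ) : ℝ) / a + deBruijnPhiDeriv a / deBruijnPhi a = 0) :
    xiMoment m * xiMoment (m + 4) *
        (1 - 4 / ((m + 4 : ℝ) + D) - 4 / (m + 4 : ℝ) * ((∫ u in Ioo 0 u₀, deBruijnPhi u * u ^ m) / xiMoment m)) ≤
      xiMoment (m + 2) ^ 2 := by
  have hkey := lintegral_invSq_var_le m ha hu₀ hD0 hD hmode
  set f : ℝ → ℝ := fun u => ((u ^ 2)⁻¹ - (a ^ 2)⁻¹) ^ 2 * (deBruijnPhi u * u ^ (m + 4)) with hf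
  set g : ℝ → ℝ := fun u => (a ^ 4)⁻¹ * (a ^ 4 * (deBruijnPhi u * u ^ m) - 2 * a ^ 2 * (deBruijnPhi u * u ^ (m + 2)) +
    deBruijnPhi u * u ^ (m + 4)) with hg
  have hfg : EqOn f g (Ioi 0) := fun u hu => invSq_var_integrand_eq m ha hu
  have hI := integrableOn_deBruijnPhi_mul_pow
  have h12 : IntegrableOn (fun u => a ^ 4 * (deBruijnPhi u * u ^ m) - 2 * a ^ 2 * (deBruijnPhi u * u ^ (m + 2))) (Ioi 0) :=
    ((hI m).const_mul (a ^ 4)).sub ((hI (m + 2)).const_mul (2 * a ^ 2))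
  have hgint : IntegrableOn g (Ioi 0) := (h12.add (hI (m + 4))).const_mul ((a ^ 4)⁻¹)
  have hfint : IntegrableOn f (Ioi 0) := hgint.congr_fun hfg.symm measurableSet_Ioi
  have hfval : ∫ u in Ioi 0, f u =
      (a ^ 4)⁻¹ * (a ^ 4 * xiMoment m - 2 * a ^ 2 * xiMoment (m + 2) + xiMoment (m + 4)) := by
    rw [setIntegral_congr_fun measurableSet_Ioi hfg]
    simp only [hg]
    rw [integral_const_mul, integral_add h12 (hI (m + 4)), integral_sub ((hI m).const_mul _) ((hI (m + 2)).const_mul _),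
      integral_const_mul, integral_const_mul]
    rfl
  have hf0 : ∀ u ∈ Ioi (0 : ℝ), 0 ≤ f u := fun u hu =>
    mul_nonneg (sq_nonneg _) (mul_pos (deBruijnPhi_pos_holds u) (pow_pos hu _)).le
  have hw0 : ∀ u ∈ Ioi (0 : ℝ), 0 ≤ deBruijnPhi u * u ^ m := fun u hu =>
    (mul_pos (deBruijnPhi_pos_holds u) (pow_pos hu _)).le
  have eL : ∫⁻ u in Ioi 0, ENNReal.ofReal (f u) = ENNReal.ofReal (∫ u in Ioi 0, f u) :=
    (ofReal_integral_eq_lintegral_ofReal hfint ((ae_restrict_iff' measurableSet_Ioi).2 (ae_of_all _ hf0))).symm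
  have hI1 : IntegrableOn (fun u => deBruijnPhi u * u ^ m) (Ioi 0 ∩ Ici u₀) := (hI m).mono_set inter_subset_left
  have hI2 : IntegrableOn (fun u => deBruijnPhi u * u ^ m) (Ioi 0 ∩ Iio u₀) := (hI m).mono_set inter_subset_left
  have e1 : ∫⁻ u in Ioi 0 ∩ Ici u₀, ENNReal.ofReal (deBruijnPhi u * u ^ m) =
      ENNReal.ofReal (∫ u in Ioi 0 ∩ Ici u₀, deBruijnPhi u * u ^ m) :=
    (ofReal_integral_eq_lintegral_ofReal hI1 ((ae_restrict_iff' (measurableSet_Ioi.inter measurableSet_Ici)).2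
      (ae_of_all _ fun u hu => hw0 u hu.1))).symm
  have e2 : ∫⁻ u in Ioi 0 ∩ Iio u₀, ENNReal.ofReal (deBruijnPhi u * u ^ m) =
      ENNReal.ofReal (∫ u in Ioi 0 ∩ Iio u₀, deBruijnPhi u * u ^ m) :=
    (ofReal_integral_eq_lintegral_ofReal hI2 ((ae_restrict_iff' (measurableSet_Ioi.inter measurableSet_Iio)).2
      (ae_of_all _ fun u hu => hw0 u hu.1))).symm
  have hA0 : 0 ≤ ∫ u in Ioi 0 ∩ Ici u₀, deBruijnPhi u * u ^ m :=
    setIntegral_nonneg (measurableSet_Ioi.inter measurableSet_Ici) fun u hu => hw0 u hu.1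
  have hB0 : 0 ≤ ∫ u in Ioi 0 ∩ Iio u₀, deBruijnPhi u * u ^ m :=
    setIntegral_nonneg (measurableSet_Ioi.inter measurableSet_Iio) fun u hu => hw0 u hu.1
  have hc1 : 0 ≤ 4 / ((m + 4 : ℝ) + D) := by positivity
  have hc2 : 0 ≤ 4 / (m + 4 : ℝ) := by positivity
  have hkey' : ENNReal.ofReal (∫ u in Ioi 0, f u) ≤
      ENNReal.ofReal (4 / ((m + 4 : ℝ) + D) * (∫ u in Ioi 0 ∩ Ici u₀, deBruijnPhi u * u ^ m) +
        4 / (m + 4 : ℝ) * (∫ u in Ioi 0 ∩ Iio u₀, deBruijnPhi u * u ^ m)) := by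
    have h := hkey
    rw [eL, e1, e2, ← ENNReal.ofReal_mul hc1, ← ENNReal.ofReal_mul hc2,
      ← ENNReal.ofReal_add (by positivity) (by positivity)] at h
    exact h
  have hreal := (ENNReal.ofReal_le_ofReal_iff (by positivity)).1 hkey'
  -- the two pieces: `≤ M_m` and `= I₀`
  have hA : ∫ u in Ioi 0 ∩ Ici u₀, deBruijnPhi u * u ^ m ≤ xiMoment m := by
    refine setIntegral_mono_set (hI m) ?_ inter_subset_left.eventuallyLE
    exact (ae_restrict_iff' measurableSet_Ioi).2 (ae_of_all _ hw0)
  have hB : ∫ u in Ioi 0 ∩ Iio u₀, deBruijnPhi u * u ^ m = ∫ u in Ioo 0 u₀, deBruijnPhi u * u ^ m := by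
    rw [Ioi_inter_Iio]
  -- variance ≤ second moment about `a⁻²`
  have hMm := xiMoment_pos m
  have hC := xiMoment_pos (m + 4)
  have hvar : xiMoment m - xiMoment (m + 2) ^ 2 / xiMoment (m + 4) ≤ ∫ u in Ioi 0, f u := by
    rw [hfval]
    have ha' : a ≠ 0 := ha.ne'
    have e : (a ^ 4)⁻¹ * (a ^ 4 * xiMoment m - 2 * a ^ 2 * xiMoment (m + 2) + xiMoment (m + 4)) -
        (xiMoment m - xiMoment (m + 2) ^ 2 / xiMoment (m + 4)) =
        (a ^ 2 * xiMoment (m + 2) - xiMoment (m + 4)) ^ 2 / (a ^ 4 * xiMoment (m + 4)) := by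
      field_simp
      ring
    have h0 : 0 ≤ (a ^ 2 * xiMoment (m + 2) - xiMoment (m + 4)) ^ 2 / (a ^ 4 * xiMoment (m + 4)) := by positivity
    linarith
  -- combine
  have hsum : xiMoment m - xiMoment (m + 2) ^ 2 / xiMoment (m + 4) ≤
      4 / ((m + 4 : ℝ) + D) * xiMoment m + 4 / (m + 4 : ℝ) * ∫ u in Ioo 0 u₀, deBruijnPhi u * u ^ m := by
    have := mul_le_mul_of_nonneg_left hA hc1
    rw [hB] at hreal
    linarith
  have e3 : xiMoment m * xiMoment (m + 4) *
      (1 - 4 / ((m + 4 : ℝ) + D) - 4 / (m + 4 : ℝ) * ((∫ u in Ioo 0 u₀, deBruijnPhi u * u ^ m) / xiMoment m)) =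
      xiMoment (m + 4) * (xiMoment m - 4 / ((m + 4 : ℝ) + D) * xiMoment m -
        4 / (m + 4 : ℝ) * ∫ u in Ioo 0 u₀, deBruijnPhi u * u ^ m) := by
    field_simp
  rw [e3]
  have h2 : xiMoment m - 4 / ((m + 4 : ℝ) + D) * xiMoment m - 4 / (m + 4 : ℝ) * ∫ u in Ioo 0 u₀, deBruijnPhi u * u ^ m ≤
      xiMoment (m + 2) ^ 2 / xiMoment (m + 4) := by linarith
  calc xiMoment (m + 4) * (xiMoment m - 4 / ((m + 4 : ℝ) + D) * xiMoment m -
        4 / (m + 4 : ℝ) * ∫ u in Ioo 0 u₀, deBruijnPhi u * u ^ m)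
      ≤ xiMoment (m + 4) * (xiMoment (m + 2) ^ 2 / xiMoment (m + 4)) := mul_le_mul_of_nonneg_left h2 hC.le
    _ = xiMoment (m + 2) ^ 2 := by field_simp

end Summit.RiemannHypothesis.RiemannHypothesis.Theorems.JensenPolynomials

end
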